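import Literature.NumberTheory.QuadraticFields.QuadraticDedekindZeta
import HarnessLib

/-!
# `ζ_K(s) = ζ(s) · L(s, κ)` for a quadratic field and ANY Dirichlet character `κ` with the
# Kronecker values `κ(p) = (d_K / p)` — even discriminants included — and the class number formula

Topic `NumberTheory/QuadraticFields`, namespace `Literature.NumberTheory.QuadraticFields.Quadratic`
(continuing `QuadraticDedekindZeta.lean`, which treats ODD discriminants with `κ = (· / |d_K|)`).
Everything here is PROVED (theorems only; no definitions, no named facts).

Let `K` be a quadratic field (`[K : ℚ] = 2`, any sign, any parity of `d_K`) and let `κ` be a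
Dirichlet character (to any modulus) whose values at primes are those of the Kronecker symbol
`(d_K / ·)`: `κ(p) = (d_K / p)` (Legendre symbol) for odd primes `p`, and
`κ(2) = 1, −1, 0` according as `d_K ≡ 1, 5 (mod 8)` or `d_K` is even.  We prove

* `finprod_primesOver_eq_of_kronecker` — the local Euler factors
  `∏_{𝔭 ∣ p} (1 − f(N𝔭))⁻¹ = (1 − f(p))⁻¹ (1 − κ(p) f(p))⁻¹` for every prime `p` and completely
  multiplicative `f` — the decomposition law (Cox, *Primes of the form x² + ny²*, Prop. 5.16:
  `p𝓞_K = 𝔭², 𝔭𝔭', 𝔭` according as `(d_K/p) = 0, 1, −1`) through Dedekind–Kummer for `𝓞 K = ℤ[ω]`,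
  exactly as in `finprod_primesOver_eq`, plus the ramified prime `2` of an even discriminant
  (`X² − tX − m ≡ (X − m)² (mod 2)` when `t` is even);
* `dedekindZeta_eq_riemannZeta_mul_LSeries_of_kronecker` — **`ζ_K(s) = ζ(s) L(s, κ)`**, `Re s > 1`
  (Neukirch VII (5.12) / Montgomery–Vaughan §10.1 Ex. 26, now for all quadratic fields);
* `LFunction_one_eq_dedekindZeta_residue_of_eq` and `LFunction_one_eq_of_discr_neg_of_eq` —
  **Dirichlet's class number formula** for any `κ ≠ 1` with `ζ_K = ζ · L(κ)` on `Re s > 1`: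
  `L(1, κ) = 2^{r₁}(2π)^{r₂} R h/(w√|d_K|)`, `= 2πh/(w√|d_K|)` when `d_K < 0` (Neukirch VII §5,
  after (5.11); Mathlib's residue `NumberField.tendsto_sub_one_mul_dedekindZeta_nhdsGT`).

For odd `d_K` the tree's `jacobiChar |d_K|` has these values (`jacobiSym_natAbs_eq_of_emod_four_eq_one`,
`jacobiSym_two_natAbs_eq_one_iff`, `…_neg_one_iff`); for even `d_K = 4m` the character mod `4|m|`
of `KroneckerCharacterFourProofs.lean` (`exists_dirichletCharacter_four_mul`) does
(`apply_prime_eq_legendreSym`, `apply_eq_zero_of_even`) — so both parities are now covered, which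
is what statements over "all primitive quadratic characters" (odd conductor `q ≡ 3 (mod 4)` AND
even conductors `4m`, `8m`) require.

## References

* [Cox2013] D. A. Cox, *Primes of the form x² + ny²*, 2nd ed. (2013), §5.B Prop. 5.16.
* [NeukirchANT1999] J. Neukirch, *Algebraic Number Theory* (1999), Ch. VII §5, (5.11)–(5.12).
* [MontgomeryVaughan2007] H. L. Montgomery, R. C. Vaughan, *Multiplicative Number Theory I*
  (2007), §10.1 Exercise 26.
-/

noncomputable section

open Module NumberField Polynomial Ideal UniqueFactorizationMonoid IsDedekindDomain
open scoped NumberTheorySymbols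

namespace Literature.NumberTheory.QuadraticFields.Quadratic

/-! ### Two more quadratics over `𝔽₂` (the ramified prime `2`) -/

section Field

variable {F : Type*} [Field F] [DecidableEq F]

/-- Every monic irreducible factor of `X² = (X − 0)²` has degree `1`. [folklore] -/
theorem natDegree_eq_one_of_mem_zero_zero {Q : F[X]}
    (hQ : Q ∈ (normalizedFactors (X ^ 2 - C 0 * X - C 0 : F[X])).toFinset) : Q.natDegree = 1 := by
  rw [show (X ^ 2 - C 0 * X - C 0 : F[X]) = (X - C 0) ^ 2 by
      rw [sq (X - C 0)]; exact X_sq_sub_eq_mul (by ring) (by ring),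
    toFinset_normalizedFactors_sq, Finset.mem_singleton] at hQ
  rw [hQ, natDegree_X_sub_C]

/-- Over `𝔽₂`: every monic irreducible factor of `X² − 1 = (X − 1)²` has degree `1`. [folklore] -/
theorem natDegree_eq_one_of_mem_zero_one_zmod_two {Q : (ZMod 2)[X]}
    (hQ : Q ∈ (normalizedFactors (X ^ 2 - C 0 * X - C 1 : (ZMod 2)[X])).toFinset) :
    Q.natDegree = 1 := by
  rw [show (X ^ 2 - C 0 * X - C 1 : (ZMod 2)[X]) = (X - C 1) ^ 2 by
      rw [sq (X - C 1)]; exact X_sq_sub_eq_mul (by decide) (by decide),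
    toFinset_normalizedFactors_sq, Finset.mem_singleton] at hQ
  rw [hQ, natDegree_X_sub_C]

end Field

/-! ### The local Euler factors for Kronecker values -/

section Local

variable {K : Type*} [Field K] [NumberField K]

/-- **Local Euler factors of a quadratic field, any discriminant.**  Let `[K : ℚ] = 2`, let `κ` be
a Dirichlet character with `κ(p) = (d_K / p)` for odd primes `p` and `κ(2) = 1, −1, 0` according
as `d_K ≡ 1, 5 (mod 8)` or `2 ∣ d_K`, let `p` be prime and `f : ℕ →* ℂ` completely multiplicative.
Then `∏_{𝔭 ∣ p} (1 − f(N𝔭))⁻¹ = (1 − f(p))⁻¹ · (1 − κ(p) f(p))⁻¹` (decomposition law, Cox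
Prop. 5.16, via Dedekind–Kummer for `ℤ[ω]`, `ω² = m + tω`, `d_K = t² + 4m`; for even `t` the prime
`2` is ramified: `X² − tX − m ≡ (X − m)² (mod 2)`). [cite: Cox2013, §5.B Prop. 5.16 (PDF p. 119)] -/
theorem finprod_primesOver_eq_of_kronecker (h2 : finrank ℚ K = 2) {M : ℕ}
    (κ : DirichletCharacter ℂ M)
    (hoddp : ∀ p : ℕ, p.Prime → p ≠ 2 → κ p = (J(NumberField.discr K | p) : ℂ))
    (htwo : κ 2 = if NumberField.discr K % 8 = 1 then 1
      else if NumberField.discr K % 8 = 5 then -1 else 0)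
    (f : ℕ →* ℂ) {p : ℕ} (hp : p.Prime) :
    ∏ᶠ P ∈ primesOver (span {(p : ℤ)}) (𝓞 K), (1 - f (absNorm P))⁻¹ =
      (1 - f p)⁻¹ * (1 - κ p * f p)⁻¹ := by
  haveI := Fact.mk hp
  obtain ⟨b, hb⟩ := exists_basis_zero_eq_one h2
  have hD := discr_eq_sq_add_four_mul b hb
  set D := NumberField.discr K with hDdef
  generalize ht : b.repr (b 1 * b 1) 1 = t at hD
  generalize hm : b.repr (b 1 * b 1) 0 = m at hD
  -- the factors of `X² − tX − m (mod p)` control norms (`hnorm`) and the number of primes (`hcount`)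
  have hnorm : ∀ {d : ℕ}, (∀ Q ∈ (normalizedFactors (X ^ 2 - C ((t : ℤ) : ZMod p) * X
      - C ((m : ℤ) : ZMod p))).toFinset, Q.natDegree = d) →
      ∀ P ∈ primesOver (span {(p : ℤ)}) (𝓞 K), absNorm P = p ^ d := by
    intro d hd P hP
    refine absNorm_eq_pow_of_forall_natDegree_eq b hb ?_ hP
    rw [ht, hm]
    exact hd
  have hcount : (primesOver (span {(p : ℤ)}) (𝓞 K)).ncard = (normalizedFactors (X ^ 2
      - C ((t : ℤ) : ZMod p) * X - C ((m : ℤ) : ZMod p))).toFinset.card := by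
    rw [ncard_primesOver_eq_card_toFinset b hb, ht, hm]
  rcases eq_or_ne p 2 with rfl | hp2
  · -- `p = 2`
    have hκ2 : κ ((2 : ℕ) : ZMod M) = κ 2 := by rw [Nat.cast_ofNat]
    rw [hκ2, htwo]
    rcases Int.even_or_odd' t with ⟨k, rfl | rfl⟩
    · /- `t` even: `d_K = 4(k² + m)` is even, `2` ramifies: one prime of norm `2`, `κ(2) = 0` -/
      have h0 : (((2 * k : ℤ)) : ZMod 2) = 0 := by
        rw [Int.cast_mul, Int.cast_ofNat, show (2 : ZMod 2) = 0 from rfl, zero_mul]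
      have hD8 : ¬ D % 8 = 1 ∧ ¬ D % 8 = 5 := by
        have e : D = 4 * (k ^ 2 + m) := by rw [hD]; ring
        omega
      rw [if_neg hD8.1, if_neg hD8.2, zero_mul, sub_zero, inv_one, mul_one]
      rw [h0] at hnorm hcount
      rcases Int.even_or_odd' m with ⟨j, rfl | rfl⟩
      · have hm0 : (((2 * j : ℤ)) : ZMod 2) = 0 := by
          rw [Int.cast_mul, Int.cast_ofNat, show (2 : ZMod 2) = 0 from rfl, zero_mul]
        rw [hm0] at hnorm hcount
        have hN := hnorm (d := 1) fun Q hQ => natDegree_eq_one_of_mem_zero_zero hQ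
        rw [card_toFinset_normalizedFactors_X_sq_sub_zero_zero] at hcount
        rw [finprod_mem_eq_of_ncard_eq_one hcount fun P hP => by rw [hN P hP, pow_one]]
      · have hm1 : (((2 * j + 1 : ℤ)) : ZMod 2) = 1 := by
          rw [Int.cast_add, Int.cast_mul, Int.cast_ofNat, show (2 : ZMod 2) = 0 from rfl, zero_mul,
            zero_add, Int.cast_one]
        rw [hm1] at hnorm hcount
        have hN := hnorm (d := 1) fun Q hQ => natDegree_eq_one_of_mem_zero_one_zmod_two hQ
        rw [card_toFinset_normalizedFactors_X_sq_sub_zero_one_zmod_two] at hcount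
        rw [finprod_mem_eq_of_ncard_eq_one hcount fun P hP => by rw [hN P hP, pow_one]]
    · /- `t` odd: `d_K` odd, as in `finprod_primesOver_eq` -/
      have h1 : (((2 * k + 1 : ℤ)) : ZMod 2) = 1 := by
        rw [Int.cast_add, Int.cast_mul, Int.cast_ofNat, show (2 : ZMod 2) = 0 from rfl, zero_mul,
          zero_add, Int.cast_one]
      obtain ⟨i, hi⟩ := Int.even_mul_succ_self k
      rcases Int.even_or_odd' m with ⟨j, rfl | rfl⟩
      · -- `m` even: `X(X − 1)`, `2` splits, `d_K ≡ 1 (mod 8)`, `κ(2) = 1`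
        have h0 : (((2 * j : ℤ)) : ZMod 2) = 0 := by
          rw [Int.cast_mul, Int.cast_ofNat, show (2 : ZMod 2) = 0 from rfl, zero_mul]
        rw [h1, h0] at hnorm hcount
        have hN := hnorm (d := 1) fun Q hQ => natDegree_eq_one_of_mem_one_zero hQ
        rw [card_toFinset_normalizedFactors_X_sq_sub_one_zero] at hcount
        have hD8 : D % 8 = 1 := by
          rw [hD]
          have : (2 * k + 1) ^ 2 + 4 * (2 * j) = 8 * (i + j) + 1 := by linear_combination 4 * hi
          omega
        rw [finprod_mem_eq_of_ncard_eq_two hcount fun P hP => by rw [hN P hP, pow_one], if_pos hD8,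
          one_mul]
      · -- `m` odd: `X² + X + 1`, `2` is inert, `d_K ≡ 5 (mod 8)`, `κ(2) = −1`
        have h1' : (((2 * j + 1 : ℤ)) : ZMod 2) = 1 := by
          rw [Int.cast_add, Int.cast_mul, Int.cast_ofNat, show (2 : ZMod 2) = 0 from rfl, zero_mul,
            zero_add, Int.cast_one]
        rw [h1, h1'] at hnorm hcount
        have hN := hnorm (d := 2) fun Q hQ => natDegree_eq_two_of_mem_one_one_zmod_two hQ
        rw [card_toFinset_normalizedFactors_X_sq_sub_one_one_zmod_two] at hcount
        have hD8 : D % 8 = 5 := by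
          rw [hD]
          have : (2 * k + 1) ^ 2 + 4 * (2 * j + 1) = 8 * (i + j) + 5 := by linear_combination 4 * hi
          omega
        have hD8' : ¬ D % 8 = 1 := by omega
        rw [finprod_mem_eq_of_ncard_eq_one hcount fun P hP => by rw [hN P hP], if_neg hD8', if_pos hD8,
          map_pow, inv_one_sub_sq]
  · -- `p` odd
    haveI : NeZero (2 : ZMod p) := ⟨two_ne_zero_zmod hp2⟩
    have hcast : (((t ^ 2 + 4 * m : ℤ)) : ZMod p) = (t : ZMod p) ^ 2 + 4 * (m : ZMod p) := by
      push_cast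
      ring
    have hJ : κ p = (legendreSym p D : ℂ) := by
      rw [hoddp p hp hp2, jacobiSym.legendreSym.to_jacobiSym]
    rw [hJ]
    by_cases h0 : ((D : ℤ) : ZMod p) = 0
    · -- ramified: `p ∣ d_K`, one prime of norm `p`, `κ(p) = 0`
      have hs : (0 : ZMod p) ^ 2 = (t : ZMod p) ^ 2 + 4 * (m : ZMod p) := by
        rw [← hcast, ← hD, h0]; ring
      have hN := hnorm (d := 1) fun Q hQ => natDegree_eq_one_of_mem_of_sq_eq hs hQ
      rw [card_toFinset_normalizedFactors_X_sq_sub_of_eq_zero (hcast ▸ hD ▸ h0)] at hcount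
      rw [finprod_mem_eq_of_ncard_eq_one hcount fun P hP => by rw [hN P hP, pow_one],
        (legendreSym.eq_zero_iff p D).mpr h0, Int.cast_zero, zero_mul, sub_zero, inv_one, mul_one]
    · by_cases hsq : IsSquare ((D : ℤ) : ZMod p)
      · -- split: two primes of norm `p`, `κ(p) = 1`
        obtain ⟨r, hr⟩ := hsq
        have hs : r ^ 2 = (t : ZMod p) ^ 2 + 4 * (m : ZMod p) := by rw [← hcast, ← hD, hr, sq]
        have hr0 : r ≠ 0 := by rintro rfl; exact h0 (by rw [hr, mul_zero])
        have hN := hnorm (d := 1) fun Q hQ => natDegree_eq_one_of_mem_of_sq_eq hs hQ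
        rw [card_toFinset_normalizedFactors_X_sq_sub_of_sq_eq hs hr0] at hcount
        rw [finprod_mem_eq_of_ncard_eq_two hcount fun P hP => by rw [hN P hP, pow_one],
          (legendreSym.eq_one_iff p h0).mpr ⟨r, hr⟩, Int.cast_one, one_mul]
      · -- inert: one prime of norm `p²`, `κ(p) = −1`
        have hns : ¬ IsSquare ((t : ZMod p) ^ 2 + 4 * (m : ZMod p)) := by rwa [← hcast, ← hD]
        have hN := hnorm (d := 2) fun Q hQ => natDegree_eq_two_of_mem_of_not_isSquare hns hQ
        rw [card_toFinset_normalizedFactors_X_sq_sub_of_not_isSquare hns] at hcount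
        rw [finprod_mem_eq_of_ncard_eq_one hcount fun P hP => by rw [hN P hP],
          (legendreSym.eq_neg_one_iff p).mpr hsq, map_pow, inv_one_sub_sq, Int.cast_neg, Int.cast_one]

end Local

/-! ### `ζ_K(s) = ζ(s) L(s, κ)` -/

section Zeta

variable {K : Type*} [Field K] [NumberField K]

/-- **`ζ_K(s) = ζ(s) · L(s, κ)` for `Re s > 1`**, for a quadratic field `K` (any discriminant) and
any Dirichlet character `κ` with the Kronecker values `κ(p) = (d_K / p)` at primes: the Euler
product of `ζ_K` regrouped by rational primes (`HasProd.primesOver_regroup`), the local factors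
`finprod_primesOver_eq_of_kronecker`, and the Euler products of `ζ` and `L(·, κ)` (Mathlib).
[cite: MontgomeryVaughan2007, §10.1 Exercise 26] -/
theorem dedekindZeta_eq_riemannZeta_mul_LSeries_of_kronecker (h2 : finrank ℚ K = 2) {M : ℕ}
    [NeZero M] (κ : DirichletCharacter ℂ M)
    (hoddp : ∀ p : ℕ, p.Prime → p ≠ 2 → κ p = (J(NumberField.discr K | p) : ℂ))
    (htwo : κ 2 = if NumberField.discr K % 8 = 1 then 1
      else if NumberField.discr K % 8 = 5 then -1 else 0)
    {s : ℂ} (hs : 1 < s.re) :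
    NumberField.dedekindZeta K s = riemannZeta s * LSeries (fun n => κ n) s := by
  have hs0 : s ≠ 0 := fun h => by rw [h, Complex.zero_re] at hs; linarith
  set f : ℕ →* ℂ := (riemannZetaSummandHom hs0 : ℕ →* ℂ) with hfdef
  have hf : ∀ n : ℕ, f n = (n : ℂ) ^ (-s) := fun n => rfl
  set G : Ideal (𝓞 K) → ℂ := fun P => (1 - f (absNorm P))⁻¹ with hG
  have h1 : HasProd (fun v : HeightOneSpectrum (𝓞 K) => G v.asIdeal) (NumberField.dedekindZeta K s) :=
    Literature.NumberTheory.LFunctions.hasProd_dedekindEulerFactor_holds K hs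
  have h2' := Literature.NumberTheory.NumberFields.HasProd.primesOver_regroup h1
  have h3 : (fun p : Nat.Primes => ∏ᶠ P ∈ primesOver (span {((p : ℕ) : ℤ)}) (𝓞 K), G P) =
      fun p : Nat.Primes => (1 - ((p : ℕ) : ℂ) ^ (-s))⁻¹ *
        (1 - κ ((p : ℕ) : ZMod M) * ((p : ℕ) : ℂ) ^ (-s))⁻¹ := by
    funext p
    rw [hG]
    dsimp only
    rw [finprod_primesOver_eq_of_kronecker h2 κ hoddp htwo f p.2, hf]
  rw [h3] at h2'
  have h4 := (riemannZeta_eulerProduct_hasProd hs).mul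
    (DirichletCharacter.LSeries_eulerProduct_hasProd κ hs)
  exact h2'.unique h4

end Zeta

/-! ### Dirichlet's class number formula for `κ` -/

section ClassNumberFormula

open Filter Topology NumberField.InfinitePlace NumberField.Units

variable {K : Type*} [Field K] [NumberField K]

/-- **Class number formula from `ζ_K = ζ · L(κ)`.**  If `κ ≠ 1` is a Dirichlet character with
`ζ_K(s) = ζ(s) L(s, κ)` for real `s > 1`, then
`L(1, κ) = 2^{r₁} (2π)^{r₂} R_K h_K / (w_K √|d_K|)`, the residue of `ζ_K` at `s = 1` (Mathlib's
analytic class number formula), because `(s − 1)ζ(s) → 1` and `L(·, κ)` is continuous at `1`.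
[cite: NeukirchANT1999, Ch. VII §5 (5.11) (analytic class number formula)] -/
theorem LFunction_one_eq_dedekindZeta_residue_of_eq {M : ℕ} [NeZero M]
    {κ : DirichletCharacter ℂ M} (hκ : κ ≠ 1)
    (hζ : ∀ s : ℝ, 1 < s →
      NumberField.dedekindZeta K s = riemannZeta s * LSeries (fun n => κ n) s) :
    κ.LFunction 1 = (NumberField.dedekindZeta_residue K : ℂ) := by
  have hK := NumberField.tendsto_sub_one_mul_dedekindZeta_nhdsGT K
  have hζ1 : Tendsto (fun s : ℝ => ((s : ℂ) - 1) * riemannZeta s) (𝓝[>] 1) (𝓝 1) :=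
    riemannZeta_residue_one.comp tendsto_ofReal_nhdsGT_one
  have hL : Tendsto (fun s : ℝ => κ.LFunction s) (𝓝[>] 1) (𝓝 (κ.LFunction 1)) := by
    have hc : Continuous κ.LFunction := (DirichletCharacter.differentiable_LFunction hκ).continuous
    exact (hc.tendsto (1 : ℂ)).comp
      ((Complex.continuous_ofReal.tendsto (1 : ℝ)).mono_left (nhdsWithin_le_nhds (s := Set.Ioi 1)))
  have hG := hζ1.mul hL
  rw [one_mul] at hG
  have heq : (fun s : ℝ => ((s : ℂ) - 1) * riemannZeta s * κ.LFunction s) =ᶠ[𝓝[>] 1]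
      fun s : ℝ => ((s : ℂ) - 1) * NumberField.dedekindZeta K s := by
    filter_upwards [self_mem_nhdsWithin] with s hs
    have hs' : 1 < (s : ℂ).re := by simpa using hs
    rw [hζ s hs, DirichletCharacter.LFunction_eq_LSeries κ hs', mul_assoc]
  exact tendsto_nhds_unique (hG.congr' heq) hK

/-- **Class number formula, imaginary quadratic case, for `κ`**: if `[K : ℚ] = 2`, `d_K < 0`, and
`κ ≠ 1` satisfies `ζ_K(s) = ζ(s) L(s, κ)` for real `s > 1`, then `L(1, κ) = 2π h_K / (w_K √|d_K|)`.
[cite: NeukirchANT1999, Ch. VII §5 (5.11) (analytic class number formula)] -/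
theorem LFunction_one_eq_of_discr_neg_of_eq (h2 : finrank ℚ K = 2) (hd : NumberField.discr K < 0)
    {M : ℕ} [NeZero M] {κ : DirichletCharacter ℂ M} (hκ : κ ≠ 1)
    (hζ : ∀ s : ℝ, 1 < s →
      NumberField.dedekindZeta K s = riemannZeta s * LSeries (fun n => κ n) s) :
    κ.LFunction 1 =
      ((2 * Real.pi * classNumber K / (torsionOrder K * Real.sqrt |(NumberField.discr K : ℝ)|) : ℝ) : ℂ) := by
  obtain ⟨h0, h1⟩ := nrRealPlaces_eq_zero_and_nrComplexPlaces_eq_one h2 hd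
  rw [LFunction_one_eq_dedekindZeta_residue_of_eq hκ hζ, NumberField.dedekindZeta_residue_def, h0, h1,
    regulator_eq_one_of_discr_neg h2 hd]
  norm_num

end ClassNumberFormula

end Literature.NumberTheory.QuadraticFields.Quadratic

end
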